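import Summits.ABC.ABC.Theses.IneffectiveSubspace

/-!
# Sketch — crux-ideate round 2, ideator 5, crux stmt-ABC-1649 `TowerFourSubLiouville`

First lemmas for the two idea cards of this seat (planner-cruxidea-stmt-ABC-1649-5-0):

* `cm-twist-integral-point` : a violator `w Z⁴ = v Y⁴ + a` of the uniform binomial quartic
  saving is an INTEGRAL point `(x, y) = (v w Y², v w² Y Z²)` on the CM curve
  `E_N : y² = x³ + N x`, `N = a v w²` (j = 1728), with `x ≥ N^{1/(2η)}`; transfer target
  `HallLang1728 κ` / `UniformLjunggren K`.
* `two-division-descent-anchor` : over `K₁ = ℚ(√(-a v)) = ℚ(E_N[2])` the element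
  `ξ₁ = v Y² + √(-a v)` has norm `v w Z⁴`; in the principal stratum `ξ₁ = ± α₁ ζ⁴` the
  `√(-av)`-coefficient gives the quartic Thue EQUATION `F(c,e) = ±1`,
  `F = β P₄ + v α' Q₄`, whose trivial point `(1,0)` is a Padé anchor when `a β² ≪ w`.
  The composition identity `descent_norm_identity` is the algebra behind it.
-/

namespace Summit.ABC.ABC.Cruxes.TowerFourSubLiouville.SketchIdeator5

open Summit.ABC.ABC.Theses.IneffectiveSubspace

/-- DICTIONARY (card `cm-twist-integral-point`): a solution of `w Z⁴ = v Y⁴ + a` gives the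
integral point `(v w Y², v w² Y Z²)` on `y² = x³ + (a v w²) x`. -/
theorem integralPoint_of_violator (a v w Y Z : ℤ) (h : w * Z ^ 4 = v * Y ^ 4 + a) :
    (v * w ^ 2 * Y * Z ^ 2) ^ 2 = (v * w * Y ^ 2) ^ 3 + (a * v * w ^ 2) * (v * w * Y ^ 2) := by
  linear_combination (v ^ 2 * w ^ 3 * Y ^ 2) * h

/-- NORM IDENTITY (card `two-division-descent-anchor`): `N_{K₁/ℚ}(v Y² + √(-av)) = v w Z⁴`. -/
theorem normK1_of_violator (a v w Y Z : ℤ) (h : w * Z ^ 4 = v * Y ^ 4 + a) :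
    (v * Y ^ 2) ^ 2 + (a * v) * 1 ^ 2 = v * w * Z ^ 4 := by
  linear_combination (-v) * h

/-- The rational and `√(-D)` parts of `(vα' + β√(-D)) · (c + e√(-D))⁴` and the composed norm
identity (Brahmagupta), `D = a v`: the algebra of the principal stratum.  With
`P₄ = c⁴ - 6 D c² e² + D² e⁴`, `Q₄ = 4 c³ e - 4 D c e³`:
rational part `R = v α' P₄ - D β Q₄`, radical part `F = β P₄ + v α' Q₄`, and
`R² + D F² = ((v α')² + D β²) · (c² + D e²)⁴`. -/
theorem descent_norm_identity (D v α' β c e : ℤ) :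
    (v * α' * (c ^ 4 - 6 * D * c ^ 2 * e ^ 2 + D ^ 2 * e ^ 4)
        - D * β * (4 * c ^ 3 * e - 4 * D * c * e ^ 3)) ^ 2
      + D * (β * (c ^ 4 - 6 * D * c ^ 2 * e ^ 2 + D ^ 2 * e ^ 4)
        + v * α' * (4 * c ^ 3 * e - 4 * D * c * e ^ 3)) ^ 2
      = ((v * α') ^ 2 + D * β ^ 2) * (c ^ 2 + D * e ^ 2) ^ 4 := by
  ring

/-- The anchor: `F(1, 0) = β`, so `(c,e) = (1,0)` solves the Thue equation `F = ±1` iff `β = ±1`,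
i.e. iff `w = v α'² + a` (the coefficient triple is "anchored": `(w - a)/v` is a square). -/
theorem anchor_value (D v α' β : ℤ) :
    β * ((1:ℤ) ^ 4 - 6 * D * 1 ^ 2 * 0 ^ 2 + D ^ 2 * 0 ^ 4) + v * α' * (4 * 1 ^ 3 * 0 - 4 * D * 1 * 0 ^ 3)
      = β := by
  ring

/-- TRANSFER TARGETS. Hall–Lang for the `j = 1728` family with exponent `κ` (any `κ` suffices
for the crux). -/
def HallLang1728 (κ : ℝ) : Prop :=
  ∃ C : ℝ, 0 < C ∧ ∀ N x y : ℤ, N ≠ 0 → y ^ 2 = x ^ 3 + N * x → (|x| : ℝ) ≤ C * (|N| : ℝ) ^ κ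

/-- Uniform Ljunggren: `x² - d y⁴ = k` (`d` not a square, `k ≠ 0`) forces `|y| ≤ C (|d| |k|)^K`. -/
def UniformLjunggren (K : ℝ) : Prop :=
  ∃ C : ℝ, 0 < C ∧ ∀ d k x y : ℤ, ¬ IsSquare d → k ≠ 0 → x ^ 2 - d * y ^ 4 = k →
    (|y| : ℝ) ≤ C * ((|d| * |k| : ℤ) : ℝ) ^ K

/-- `HallLang1728 κ → UniformLjunggren (2κ+1)`-type bookkeeping and
`UniformLjunggren K → UBQ η` for `η < 1/(4K+2)` are the two stubs of the transfer; the crux then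
follows from the LANDED `stub_transfer` (p86153).  Stated here as the first checkable target. -/
def TransferStub : Prop :=
  (∃ K : ℝ, UniformLjunggren K) → TowerFourSubLiouville

end Summit.ABC.ABC.Cruxes.TowerFourSubLiouville.SketchIdeator5
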